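import Summits.QuantumFields.YangMills.Theorems.UnitScaleTiltProp7CoarseFineKernelRows
import HarnessLib

/-!
# Route `UnitScaleTilt`, crux K1 «MinimiserStabilityRegPr» (stmt-QuantumFields-19200), EX face — K-STOREY, FILE (K5-cone, part A):
# **THE NEUMANN INVERSE IN ROW CURRENCY ON AN ABSTRACT CARRIER, AND ON THE COARSE CARRIER OF `K = Q_kGQ_k†`** — ROW ⟹ weighted column gauge ⟹ `(1 − B)⁻¹` exists with
# ROW(`1∕(1 − C·S)`, r) whenever `C·S < 1`; at the coarse carrier the volume `S = 3·(2(1+1∕ν))³` carries NO `ℓ³`, so the smallness is K-free (the cone route to `hKinv`(Π), ★p1 g27 CHAIR WORD №34)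

Cell `ym3-torus` (HUMAN RULING D-0037; rung R3 = SU(2) YM₃ on T³ — NOT d = 4, NOT infinite volume, NOT a mass gap, NOT Clay).  Width seat `ym3-torus-px10` (gen 14; FREE px; the
cone step «hKinv(Π) ⟸ hKinv(η) + the coarse kernel row of `Q_k(G_π − G₀)Q_k†`» TAKEN 2026-08-30 12:02Z).  THEOREMS ONLY (0 `def`, 0 `sorry`, default heartbeats);
`--supports stmt-QuantumFields-19200 --as helper`; count-neutral.  Part B (`…Prop7KinvPiOfCone`) docks N6 FILE D4's `G_π − G₀` rows and the identification `KinvT(Π) = W ∘ KinvT(η)`.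

WHY A NEW FILE.  px10 g12's (K1-alg) ✓`Prop7KernelRowColumnGauge` ∕ ✓`Prop7KernelRowComposition.kernelRow_inverse_of_kernelRow` are typed on the FINE carrier `BondL2K … c₀` with the fine
volume `V = d·(L^d)^{K−n} = 3ℓ³` in the smallness; `K⁻¹` lives on the COARSE carrier `WL2 ℂ (fun _ : PBond (F.P n) 0 => cB) W₂` (spikes `toL2B (δ_y Z)`, reading `toL2B⁻¹(·)(y′)`,
distance `tdist(ŷ′, ŷ)` on the block torus — the `hKinv` letter's own geometry), where one coarse site carries 3 bonds and the volume is `3·(2(1+1∕ν))³` (✓`sum_coarse_pbond_exp_neg_tdist_le`).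
So the gauge is re-typed ONCE over an ABSTRACT chart `e : (ι → V) ≃ₗ[ℂ] E` placed by `p : ι → X` in a pseudo-metric space `(X, d)` (as px10 g13's ✓`kernelRow_comp_core`), and then read at
the coarse carrier.

THE TEXTS (inline, never defined; target-first as the `hKinv` letter).  ROW(B; C, μ) := `∀ i Z j, ‖e⁻¹(B(e δ_i Z))(j)‖ ≤ C·e^{−μ·d(p j, p i)}·‖Z‖`;
COLW(B; N, r) := `∀ i Z, Σ_j ‖e⁻¹(B(e δ_i Z))(j)‖·e^{+r·d(p j, p i)} ≤ N·‖Z‖`.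
WHAT IS PROVED (ns `Summit.QuantumFields.YangMills.Theorems.Prop7CoarseKernelRowNeumann`).
§0 ABSTRACT: `symm_apply_eq_sum_single`, `exp_mul_triangle`, ★`colw_of_row` (volume `Σ_j e^{−(μ−r)d(p j, x)} ≤ S` ⟹ COLW(C·S, r)), `row_of_colw`, ★`colw_apply_le` (the weighted `ℓ¹`
bound on a general vector), ★`colw_mul`, `colw_one`, ★★`colw_of_mul_eq_one` (`(1 − B)U = 1`, `N < 1` ⟹ COLW(U; 1∕(1−N), r) — no series), `injective_one_sub_of_colw`,
★`exists_inverse_one_sub_of_colw` (finite-dimensional `E`), ★★★`row_inverse_of_row`, ★`exists_inverse_row`, `row_neg`, and the algebra of the cone step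
★★`rightInverse_eq_of_perturbation` (`K₀U₀ = 1`, `(1 + U₀E′)W = 1`, `(K₀ + E′)U₁ = 1` ⟹ `U₁ = W ∘ U₀` on a finite-dimensional carrier).
§1 COARSE MEMBER (`F n K`, `h : n ≤ K`, weight `cB`; CC texts of ✓`Prop7CoarseFineKernelRows`): ★`kernelRow_CC_comp_CC` (outer absorption, `× 3(2(1+1∕ν))³`), `kernelRow_CC_neg`,
★★★`kernelRow_CC_inverse` (CC(B; C, μ), `0 ≤ r < μ`, `C·3(2(1+1∕(μ−r)))³ < 1`, `(1 − B)U = 1` ⟹ CC(U; 1∕(1 − C·3(2(1+1∕(μ−r)))³), r)), ★`exists_inverse_CC`.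
HONEST SCOPE.  Row algebra ∕ bookkeeping; no estimate of print is proved; nothing of `hKinv`, the EX rows, EX or the crux is proved here; the Yang–Mills mass gap is NOT proved.

References: T. Bałaban, CMP **99** (1985) 389–434 [Balaban1985BackgroundPropagators] ((3.46)–(3.49) pp.398–399, (3.86) p.409, (3.131)–(3.132) pp.421–422);
CMP **96** (1984) 223–250 [Balaban1984PropagatorsII] (§2, random-walk ∕ Neumann expansions of exponentially decaying kernels).
-/

set_option autoImplicit false

noncomputable section

open scoped BigOperators Matrix.Norms.L2Operator InnerProductSpace ComplexConjugate

namespace Summit.QuantumFields.YangMills.Theorems.Prop7CoarseKernelRowNeumann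

open Literature.MathematicalPhysics.QuantumFieldTheory.Balaban1983to89
open Literature.MathematicalPhysics.QuantumFieldTheory.Balaban1983to89.T3ContinuumYM3Torus
open T3PrintedRegularOrbits (sites_eq)
open T3LevelShift (siteShift)
open B9Eq311L2Pairing (WL2)
open Summit.QuantumFields.YangMills.Theorems.Prop7SectET3HilbertLetters (W₂ toL2B)
open Summit.QuantumFields.YangMills.Theorems.Prop7BlockDistanceWeights (tdist_coarse_comm tdist_coarse_triangle)
open Summit.QuantumFields.YangMills.Theorems.Prop7KernelRowColumnGauge (tdist_coarse_self)
open Summit.QuantumFields.YangMills.Theorems.Prop7CoarseFineKernelRows (kernelRow_comp_outer)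
open Summit.QuantumFields.YangMills.Theorems.Prop7Op137OfKernelRows (sum_coarse_pbond_exp_neg_tdist_le)

/-! ## §0 The abstract gauge and the Neumann inverse -/

section Abstract
variable {ι X V E : Type*} [Fintype ι] [DecidableEq ι] [NormedAddCommGroup V] [Module ℂ V] [AddCommGroup E] [Module ℂ E]
  (e : (ι → V) ≃ₗ[ℂ] E) (d : X → X → ℝ) (p : ι → X)

/-- `e⁻¹(B(e X))(j) = Σ_i e⁻¹(B(e (δ_i X(i))))(j)` — linearity over the spike expansion. [folklore] -/
theorem symm_apply_eq_sum_single (B : E →ₗ[ℂ] E) (Xf : ι → V) (j : ι) :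
    e.symm (B (e Xf)) j = ∑ i, e.symm (B (e (Pi.single i (Xf i)))) j := by
  conv_lhs => rw [← Finset.univ_sum_single Xf]
  rw [map_sum, map_sum, map_sum, Finset.sum_apply]

/-- The weight triangle `e^{r d(x,z)} ≤ e^{r d(x,y)}·e^{r d(y,z)}` for `0 ≤ r`. [folklore] -/
theorem exp_mul_triangle (hdt : ∀ x y z, d x z ≤ d x y + d y z) {r : ℝ} (hr : 0 ≤ r) (x y z : X) :
    Real.exp (r * d x z) ≤ Real.exp (r * d x y) * Real.exp (r * d y z) := by
  rw [← Real.exp_add, Real.exp_le_exp]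
  nlinarith [mul_le_mul_of_nonneg_left (hdt x y z) hr]

/-- ★ **ROW ⟹ COLW**: ROW(B; C, μ), `0 ≤ C`, and the volume `Σ_j e^{−(μ−r)·d(p j, x)} ≤ S` ⟹ COLW(B; C·S, r). [cite: Balaban1985BackgroundPropagators, (3.49) p.399] -/
theorem colw_of_row (B : E →ₗ[ℂ] E) {C μ r S : ℝ} (hC : 0 ≤ C) (hvol : ∀ x : X, ∑ j, Real.exp (-((μ - r) * d (p j) x)) ≤ S)
    (hrow : ∀ (i : ι) (Z : V) (j : ι), ‖e.symm (B (e (Pi.single i Z))) j‖ ≤ C * Real.exp (-(μ * d (p j) (p i))) * ‖Z‖) (i : ι) (Z : V) :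
    ∑ j, ‖e.symm (B (e (Pi.single i Z))) j‖ * Real.exp (r * d (p j) (p i)) ≤ C * S * ‖Z‖ := by
  have h1 : ∀ j, ‖e.symm (B (e (Pi.single i Z))) j‖ * Real.exp (r * d (p j) (p i)) ≤ C * ‖Z‖ * Real.exp (-((μ - r) * d (p j) (p i))) := by
    intro j
    calc ‖e.symm (B (e (Pi.single i Z))) j‖ * Real.exp (r * d (p j) (p i))
        ≤ (C * Real.exp (-(μ * d (p j) (p i))) * ‖Z‖) * Real.exp (r * d (p j) (p i)) := mul_le_mul_of_nonneg_right (hrow i Z j) (Real.exp_pos _).le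
      _ = C * ‖Z‖ * (Real.exp (-(μ * d (p j) (p i))) * Real.exp (r * d (p j) (p i))) := by ring
      _ = C * ‖Z‖ * Real.exp (-((μ - r) * d (p j) (p i))) := by rw [← Real.exp_add]; congr 1; ring
  calc ∑ j, ‖e.symm (B (e (Pi.single i Z))) j‖ * Real.exp (r * d (p j) (p i))
      ≤ ∑ j, C * ‖Z‖ * Real.exp (-((μ - r) * d (p j) (p i))) := Finset.sum_le_sum fun j _ => h1 j
    _ = C * ‖Z‖ * ∑ j, Real.exp (-((μ - r) * d (p j) (p i))) := by rw [Finset.mul_sum]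
    _ ≤ C * ‖Z‖ * S := mul_le_mul_of_nonneg_left (hvol (p i)) (by positivity)
    _ = C * S * ‖Z‖ := by ring

/-- **COLW ⟹ ROW** with the same letters: one term of a non-negative sum. [folklore] -/
theorem row_of_colw (B : E →ₗ[ℂ] E) {N r : ℝ}
    (hcol : ∀ (i : ι) (Z : V), ∑ j, ‖e.symm (B (e (Pi.single i Z))) j‖ * Real.exp (r * d (p j) (p i)) ≤ N * ‖Z‖) (i : ι) (Z : V) (j : ι) :
    ‖e.symm (B (e (Pi.single i Z))) j‖ ≤ N * Real.exp (-(r * d (p j) (p i))) * ‖Z‖ := by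
  have hE := Real.exp_pos (r * d (p j) (p i))
  have hle : ‖e.symm (B (e (Pi.single i Z))) j‖ * Real.exp (r * d (p j) (p i)) ≤ N * ‖Z‖ :=
    (Finset.single_le_sum (f := fun j' => ‖e.symm (B (e (Pi.single i Z))) j'‖ * Real.exp (r * d (p j') (p i)))
      (fun j' _ => by positivity) (Finset.mem_univ j)).trans (hcol i Z)
  rw [Real.exp_neg]; rw [← le_div_iff₀ hE] at hle
  calc ‖e.symm (B (e (Pi.single i Z))) j‖ ≤ N * ‖Z‖ / Real.exp (r * d (p j) (p i)) := hle
    _ = _ := by field_simp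

/-- ★ **THE WEIGHTED `ℓ¹` BOUND ON A GENERAL VECTOR**: COLW(B; N, r), `0 ≤ r`, triangle ⟹ `Σ_j ‖e⁻¹(B(e X))(j)‖·e^{r d(p j, x₀)} ≤ N·Σ_i ‖X i‖·e^{r d(p i, x₀)}`.
[cite: Balaban1984PropagatorsII, §2] -/
theorem colw_apply_le (hdt : ∀ x y z, d x z ≤ d x y + d y z) (B : E →ₗ[ℂ] E) {N r : ℝ} (hr : 0 ≤ r)
    (hcol : ∀ (i : ι) (Z : V), ∑ j, ‖e.symm (B (e (Pi.single i Z))) j‖ * Real.exp (r * d (p j) (p i)) ≤ N * ‖Z‖) (Xf : ι → V) (x₀ : X) :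
    ∑ j, ‖e.symm (B (e Xf)) j‖ * Real.exp (r * d (p j) x₀) ≤ N * ∑ i, ‖Xf i‖ * Real.exp (r * d (p i) x₀) := by
  have hN : ∀ i, ∑ j, ‖e.symm (B (e (Pi.single i (Xf i)))) j‖ * Real.exp (r * d (p j) (p i)) ≤ N * ‖Xf i‖ := fun i => hcol i (Xf i)
  calc ∑ j, ‖e.symm (B (e Xf)) j‖ * Real.exp (r * d (p j) x₀)
      ≤ ∑ j, ∑ i, ‖e.symm (B (e (Pi.single i (Xf i)))) j‖ * (Real.exp (r * d (p j) (p i)) * Real.exp (r * d (p i) x₀)) := by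
        refine Finset.sum_le_sum fun j _ => ?_
        rw [symm_apply_eq_sum_single e B Xf j]
        calc ‖∑ i, e.symm (B (e (Pi.single i (Xf i)))) j‖ * Real.exp (r * d (p j) x₀)
            ≤ (∑ i, ‖e.symm (B (e (Pi.single i (Xf i)))) j‖) * Real.exp (r * d (p j) x₀) := mul_le_mul_of_nonneg_right (norm_sum_le _ _) (Real.exp_pos _).le
          _ = ∑ i, ‖e.symm (B (e (Pi.single i (Xf i)))) j‖ * Real.exp (r * d (p j) x₀) := Finset.sum_mul _ _ _
          _ ≤ _ := Finset.sum_le_sum fun i _ => mul_le_mul_of_nonneg_left (exp_mul_triangle d hdt hr (p j) (p i) x₀) (norm_nonneg _)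
    _ = ∑ i, Real.exp (r * d (p i) x₀) * ∑ j, ‖e.symm (B (e (Pi.single i (Xf i)))) j‖ * Real.exp (r * d (p j) (p i)) := by
        rw [Finset.sum_comm]
        refine Finset.sum_congr rfl fun i _ => ?_
        rw [Finset.mul_sum]
        exact Finset.sum_congr rfl fun j _ => by ring
    _ ≤ ∑ i, Real.exp (r * d (p i) x₀) * (N * ‖Xf i‖) := Finset.sum_le_sum fun i _ => mul_le_mul_of_nonneg_left (hN i) (Real.exp_pos _).le
    _ = _ := by
        rw [Finset.mul_sum]
        exact Finset.sum_congr rfl fun i _ => by ring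

/-- ★ **COLW IS SUBMULTIPLICATIVE**: COLW(B₁; N₁, r), COLW(B₂; N₂, r), `0 ≤ r`, `0 ≤ N₁` ⟹ COLW(B₁·B₂; N₁N₂, r). [cite: Balaban1984PropagatorsII, §2] -/
theorem colw_mul (hdt : ∀ x y z, d x z ≤ d x y + d y z) (B₁ B₂ : E →ₗ[ℂ] E) {N₁ N₂ r : ℝ} (hr : 0 ≤ r) (hN₁ : 0 ≤ N₁)
    (h₁ : ∀ (i : ι) (Z : V), ∑ j, ‖e.symm (B₁ (e (Pi.single i Z))) j‖ * Real.exp (r * d (p j) (p i)) ≤ N₁ * ‖Z‖)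
    (h₂ : ∀ (i : ι) (Z : V), ∑ j, ‖e.symm (B₂ (e (Pi.single i Z))) j‖ * Real.exp (r * d (p j) (p i)) ≤ N₂ * ‖Z‖) (i : ι) (Z : V) :
    ∑ j, ‖e.symm ((B₁ * B₂) (e (Pi.single i Z))) j‖ * Real.exp (r * d (p j) (p i)) ≤ N₁ * N₂ * ‖Z‖ := by
  have hX : (B₁ * B₂) (e (Pi.single i Z)) = B₁ (e (e.symm (B₂ (e (Pi.single i Z))))) := by
    rw [Module.End.mul_apply, LinearEquiv.apply_symm_apply]
  simp_rw [hX]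
  refine (colw_apply_le e d p hdt B₁ hr h₁ _ (p i)).trans ?_
  calc N₁ * ∑ i', ‖e.symm (B₂ (e (Pi.single i Z))) i'‖ * Real.exp (r * d (p i') (p i)) ≤ N₁ * (N₂ * ‖Z‖) := mul_le_mul_of_nonneg_left (h₂ i Z) hN₁
    _ = _ := by ring

/-- COLW(1; 1, r): the identity's weighted column sum is `‖Z‖` (`d(x, x) = 0`). [folklore] -/
theorem colw_one (hdd : ∀ x, d x x = 0) (r : ℝ) (i : ι) (Z : V) :
    ∑ j, ‖e.symm ((1 : Module.End ℂ E) (e (Pi.single i Z))) j‖ * Real.exp (r * d (p j) (p i)) ≤ 1 * ‖Z‖ := by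
  simp_rw [Module.End.one_apply, LinearEquiv.symm_apply_apply]
  rw [Finset.sum_eq_single i (fun j _ hj => by rw [Pi.single_eq_of_ne hj, norm_zero, zero_mul]) (fun h => absurd (Finset.mem_univ i) h),
    Pi.single_eq_same, hdd, mul_zero, Real.exp_zero, mul_one, one_mul]

/-- ★★ **THE INVERSE'S GAUGE FROM A LEFT-INVERSE IDENTITY, WITHOUT A SERIES**: COLW(B; N, r), `0 ≤ r`, `N < 1`, `(1 − B)·U = 1` ⟹ COLW(U; 1∕(1−N), r) — `U = 1 + B·U`, so the finite
weighted sum obeys `S_U ≤ ‖Z‖ + N·S_U`. [cite: Balaban1985BackgroundPropagators, (3.86) p.409; Balaban1984PropagatorsII, §2] -/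
theorem colw_of_mul_eq_one (hdd : ∀ x, d x x = 0) (hdt : ∀ x y z, d x z ≤ d x y + d y z) (B U : E →ₗ[ℂ] E) {N r : ℝ} (hr : 0 ≤ r) (hN1 : N < 1)
    (hcol : ∀ (i : ι) (Z : V), ∑ j, ‖e.symm (B (e (Pi.single i Z))) j‖ * Real.exp (r * d (p j) (p i)) ≤ N * ‖Z‖)
    (hU : (1 - B) * U = 1) (i : ι) (Z : V) :
    ∑ j, ‖e.symm (U (e (Pi.single i Z))) j‖ * Real.exp (r * d (p j) (p i)) ≤ (1 / (1 - N)) * ‖Z‖ := by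
  -- `U v = v + B (U v)`
  have hfix : U (e (Pi.single i Z)) = e (Pi.single i Z) + B (U (e (Pi.single i Z))) := by
    have h := congrArg (fun T : E →ₗ[ℂ] E => T (e (Pi.single i Z))) hU
    simp only [Module.End.mul_apply, LinearMap.sub_apply, Module.End.one_apply] at h
    exact sub_eq_iff_eq_add.mp h
  have hpt : ∀ j, e.symm (U (e (Pi.single i Z))) j = (Pi.single i Z : ι → V) j + e.symm (B (e (e.symm (U (e (Pi.single i Z)))))) j := by
    intro j
    rw [LinearEquiv.apply_symm_apply]
    conv_lhs => rw [hfix]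
    rw [map_add, LinearEquiv.symm_apply_apply, Pi.add_apply]
  set S := ∑ j, ‖e.symm (U (e (Pi.single i Z))) j‖ * Real.exp (r * d (p j) (p i)) with hS
  have hB := colw_apply_le e d p hdt B hr hcol (e.symm (U (e (Pi.single i Z)))) (p i)
  have hI := colw_one e d p hdd r i Z
  simp_rw [Module.End.one_apply, LinearEquiv.symm_apply_apply] at hI
  have hSle : S ≤ ‖Z‖ + N * S := by
    calc S = ∑ j, ‖(Pi.single i Z : ι → V) j + e.symm (B (e (e.symm (U (e (Pi.single i Z)))))) j‖ * Real.exp (r * d (p j) (p i)) :=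
          Finset.sum_congr rfl fun j _ => by rw [← hpt j]
      _ ≤ ∑ j, (‖(Pi.single i Z : ι → V) j‖ * Real.exp (r * d (p j) (p i)) + ‖e.symm (B (e (e.symm (U (e (Pi.single i Z)))))) j‖ * Real.exp (r * d (p j) (p i))) := by
          refine Finset.sum_le_sum fun j _ => ?_
          rw [← add_mul]
          exact mul_le_mul_of_nonneg_right (norm_add_le _ _) (Real.exp_pos _).le
      _ ≤ 1 * ‖Z‖ + N * S := by rw [Finset.sum_add_distrib]; exact add_le_add hI hB
      _ = ‖Z‖ + N * S := by ring
  have h1N : 0 < 1 - N := by linarith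
  rw [div_mul_eq_mul_div, one_mul, le_div_iff₀ h1N]
  nlinarith

/-- **`1 − B` IS INJECTIVE** when COLW(B; N, r) with `0 ≤ r`, `N < 1`: `x = Bx` forces the weighted `ℓ¹` mass of `x` to vanish. [cite: Balaban1984PropagatorsII, §2] -/
theorem injective_one_sub_of_colw (hdt : ∀ x y z, d x z ≤ d x y + d y z) (B : E →ₗ[ℂ] E) {N r : ℝ} (hr : 0 ≤ r) (hN1 : N < 1)
    (hcol : ∀ (i : ι) (Z : V), ∑ j, ‖e.symm (B (e (Pi.single i Z))) j‖ * Real.exp (r * d (p j) (p i)) ≤ N * ‖Z‖) :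
    Function.Injective ((1 - B : E →ₗ[ℂ] E)) := by
  rw [← LinearMap.ker_eq_bot, LinearMap.ker_eq_bot']
  intro v hv
  have hv' : B v = v := by
    have : v - B v = 0 := by simpa [LinearMap.sub_apply, Module.End.one_apply] using hv
    exact (sub_eq_zero.mp this).symm
  set Xf := e.symm v with hX
  have hvX : v = e Xf := by rw [hX, LinearEquiv.apply_symm_apply]
  suffices hX0 : Xf = 0 by rw [hvX, hX0, map_zero]
  rcases isEmpty_or_nonempty ι with hE | ⟨⟨i₀⟩⟩
  · exact funext fun i => (hE.false i).elim
  have hB := colw_apply_le e d p hdt B hr hcol Xf (p i₀)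
  rw [← hvX, hv', ← hX] at hB
  have hS0 : 0 ≤ ∑ i, ‖Xf i‖ * Real.exp (r * d (p i) (p i₀)) := Finset.sum_nonneg fun i _ => by positivity
  have hS : ∑ i, ‖Xf i‖ * Real.exp (r * d (p i) (p i₀)) = 0 := by nlinarith
  rw [Finset.sum_eq_zero_iff_of_nonneg fun i _ => by positivity] at hS
  funext i
  have := hS i (Finset.mem_univ _)
  rw [mul_eq_zero] at this
  rcases this with h | h
  · exact norm_eq_zero.mp h
  · exact absurd h (Real.exp_pos _).ne'

/-- ★ **`1 − B` IS INVERTIBLE** when COLW(B; N, r) with `0 ≤ r`, `N < 1` on a finite-dimensional carrier: a two-sided inverse exists. [cite: Balaban1984PropagatorsII, §2] -/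
theorem exists_inverse_one_sub_of_colw [FiniteDimensional ℂ E] (hdt : ∀ x y z, d x z ≤ d x y + d y z) (B : E →ₗ[ℂ] E) {N r : ℝ} (hr : 0 ≤ r) (hN1 : N < 1)
    (hcol : ∀ (i : ι) (Z : V), ∑ j, ‖e.symm (B (e (Pi.single i Z))) j‖ * Real.exp (r * d (p j) (p i)) ≤ N * ‖Z‖) :
    ∃ U : E →ₗ[ℂ] E, (1 - B) * U = 1 ∧ U * (1 - B) = 1 := by
  have hinj := injective_one_sub_of_colw e d p hdt B hr hN1 hcol
  have hbij : Function.Bijective ((1 - B : E →ₗ[ℂ] E)) := ⟨hinj, LinearMap.surjective_of_injective hinj⟩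
  let f : E ≃ₗ[ℂ] E := LinearEquiv.ofBijective (1 - B) hbij
  refine ⟨(f.symm : E →ₗ[ℂ] E), ?_, ?_⟩
  · ext v
    have : (1 - B) (f.symm v) = v := f.apply_symm_apply v
    simpa [Module.End.mul_apply] using this
  · ext v
    have : f.symm ((1 - B) v) = v := f.symm_apply_apply v
    simpa [Module.End.mul_apply] using this

/-- ★★★ **THE NEUMANN INVERSE IN ROW CURRENCY (abstract)**: ROW(B; C, μ), `0 ≤ C`, `0 ≤ r`, the volume `Σ_j e^{−(μ−r)d(p j, x)} ≤ S`, `C·S < 1`, and ANY `U` with `(1 − B)·U = 1` ⟹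
ROW(U; 1∕(1 − C·S), r). [cite: Balaban1985BackgroundPropagators, (3.86) p.409, (3.131) p.421] -/
theorem row_inverse_of_row (hdd : ∀ x, d x x = 0) (hdt : ∀ x y z, d x z ≤ d x y + d y z) (B U : E →ₗ[ℂ] E) {C μ r S : ℝ} (hC : 0 ≤ C) (hr : 0 ≤ r)
    (hvol : ∀ x : X, ∑ j, Real.exp (-((μ - r) * d (p j) x)) ≤ S) (hsmall : C * S < 1)
    (hrow : ∀ (i : ι) (Z : V) (j : ι), ‖e.symm (B (e (Pi.single i Z))) j‖ ≤ C * Real.exp (-(μ * d (p j) (p i))) * ‖Z‖)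
    (hU : (1 - B) * U = 1) (i : ι) (Z : V) (j : ι) :
    ‖e.symm (U (e (Pi.single i Z))) j‖ ≤ (1 / (1 - C * S)) * Real.exp (-(r * d (p j) (p i))) * ‖Z‖ :=
  row_of_colw e d p U (colw_of_mul_eq_one e d p hdd hdt B U hr hsmall (colw_of_row e d p B hC hvol hrow) hU) i Z j

/-- ★ **EXISTENCE + ROW OF THE INVERSE (abstract)**: ROW(B; C, μ), `0 ≤ C`, `0 ≤ r`, volume `≤ S`, `C·S < 1`, finite-dimensional carrier ⟹ `1 − B` has a two-sided inverse `U` with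
ROW(U; 1∕(1 − C·S), r). [cite: Balaban1985BackgroundPropagators, (3.86) p.409, (3.131) p.421; Balaban1984PropagatorsII, §2] -/
theorem exists_inverse_row [FiniteDimensional ℂ E] (hdd : ∀ x, d x x = 0) (hdt : ∀ x y z, d x z ≤ d x y + d y z) (B : E →ₗ[ℂ] E) {C μ r S : ℝ} (hC : 0 ≤ C) (hr : 0 ≤ r)
    (hvol : ∀ x : X, ∑ j, Real.exp (-((μ - r) * d (p j) x)) ≤ S) (hsmall : C * S < 1)
    (hrow : ∀ (i : ι) (Z : V) (j : ι), ‖e.symm (B (e (Pi.single i Z))) j‖ ≤ C * Real.exp (-(μ * d (p j) (p i))) * ‖Z‖) :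
    ∃ U : E →ₗ[ℂ] E, (1 - B) * U = 1 ∧ U * (1 - B) = 1 ∧
      ∀ (i : ι) (Z : V) (j : ι), ‖e.symm (U (e (Pi.single i Z))) j‖ ≤ (1 / (1 - C * S)) * Real.exp (-(r * d (p j) (p i))) * ‖Z‖ := by
  obtain ⟨U, hU, hU'⟩ := exists_inverse_one_sub_of_colw e d p hdt B hr hsmall (colw_of_row e d p B hC hvol hrow)
  exact ⟨U, hU, hU', row_inverse_of_row e d p hdd hdt B U hC hr hvol hsmall hrow hU⟩

omit [Fintype ι] in
/-- ROW is invariant under `B ↦ −B`. [folklore] -/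
theorem row_neg (B : E →ₗ[ℂ] E) {C μ : ℝ}
    (hrow : ∀ (i : ι) (Z : V) (j : ι), ‖e.symm (B (e (Pi.single i Z))) j‖ ≤ C * Real.exp (-(μ * d (p j) (p i))) * ‖Z‖) (i : ι) (Z : V) (j : ι) :
    ‖e.symm ((-B) (e (Pi.single i Z))) j‖ ≤ C * Real.exp (-(μ * d (p j) (p i))) * ‖Z‖ := by
  rw [LinearMap.neg_apply, map_neg, Pi.neg_apply, norm_neg]; exact hrow i Z j

/-- ★★ **THE ALGEBRA OF THE CONE STEP**: on a finite-dimensional carrier, if `K₀·U₀ = 1`, `(1 + U₀·E′)·W = 1` and `(K₀ + E′)·U₁ = 1`, then `U₁ = W·U₀` — `K₀ + E′ = K₀(1 + U₀E′)`, so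
`W·U₀` is a right inverse of `K₀ + E′`, and right inverses of one map coincide (a right inverse is a left inverse). [cite: Balaban1985BackgroundPropagators, (3.131)–(3.132) pp.421–422] -/
theorem rightInverse_eq_of_perturbation [FiniteDimensional ℂ E] {K₀ U₀ E' W U₁ : E →ₗ[ℂ] E} (hK₀ : K₀ * U₀ = 1) (hW : (1 + U₀ * E') * W = 1)
    (hU₁ : (K₀ + E') * U₁ = 1) : U₁ = W * U₀ := by
  have hU₀K₀ : U₀ * K₀ = 1 := mul_eq_one_comm.mp hK₀
  have hfac : K₀ + E' = K₀ * (1 + U₀ * E') := by rw [mul_add, mul_one, ← mul_assoc, hK₀, one_mul]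
  have hR : (K₀ + E') * (W * U₀) = 1 := by rw [hfac, mul_assoc, ← mul_assoc (1 + U₀ * E') W U₀, hW, one_mul, hK₀]
  have hL : U₁ * (K₀ + E') = 1 := mul_eq_one_comm.mp hU₁
  calc U₁ = U₁ * ((K₀ + E') * (W * U₀)) := by rw [hR, mul_one]
    _ = (U₁ * (K₀ + E')) * (W * U₀) := by rw [mul_assoc]
    _ = W * U₀ := by rw [hL, one_mul]

end Abstract

/-! ## §1 The coarse member: CC rows of `WL2 … cB`-operators placed on the block torus -/

section Coarse
variable (F : T3Family) {n K : ℕ} (h : n ≤ K) (cB : ℝ)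

/-- ★ **CC ∘ CC (outer absorption)**: `M₁`, `M₂` coarse→coarse with CC(M₁; C₁, μ₁), CC(M₂; C₂, μ₂), `0 ≤ r ≤ μ₂`, `0 < ν`, `r + ν ≤ μ₁` ⟹ CC(M₁ ∘ M₂; C₁·C₂·3(2(1+1∕ν))³, r) — the
coarse volume (✓`sum_coarse_pbond_exp_neg_tdist_le`) carries NO `ℓ³`. [cite: Balaban1985BackgroundPropagators, (3.132) p.422; Balaban1984PropagatorsII, (2.61) p.234] -/
theorem kernelRow_CC_comp_CC (M₁ M₂ : WL2 ℂ (fun _ : PBond (F.P n) 0 => cB) W₂ →ₗ[ℂ] WL2 ℂ (fun _ : PBond (F.P n) 0 => cB) W₂)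
    {C₁ C₂ μ₁ μ₂ r ν : ℝ} (hC₁ : 0 ≤ C₁) (hC₂ : 0 ≤ C₂) (hr : 0 ≤ r) (hr₂ : r ≤ μ₂) (hν : 0 < ν) (hr₁ : r + ν ≤ μ₁)
    (h₁ : ∀ (y : PBond (F.P n) 0) (Z : Matrix (Fin 2) (Fin 2) ℂ) (y' : PBond (F.P n) 0),
      ‖(toL2B F n cB).symm (M₁ (toL2B F n cB (Pi.single y Z))) y'‖
        ≤ C₁ * Real.exp (-(μ₁ * (Site.tdist (P := F.P K) (siteShift (sites_eq F n K h) y'.src) (siteShift (sites_eq F n K h) y.src) : ℝ))) * ‖Z‖)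
    (h₂ : ∀ (y : PBond (F.P n) 0) (Z : Matrix (Fin 2) (Fin 2) ℂ) (y' : PBond (F.P n) 0),
      ‖(toL2B F n cB).symm (M₂ (toL2B F n cB (Pi.single y Z))) y'‖
        ≤ C₂ * Real.exp (-(μ₂ * (Site.tdist (P := F.P K) (siteShift (sites_eq F n K h) y'.src) (siteShift (sites_eq F n K h) y.src) : ℝ))) * ‖Z‖)
    (y : PBond (F.P n) 0) (Z : Matrix (Fin 2) (Fin 2) ℂ) (y' : PBond (F.P n) 0) :
    ‖(toL2B F n cB).symm ((M₁ ∘ₗ M₂) (toL2B F n cB (Pi.single y Z))) y'‖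
      ≤ C₁ * C₂ * (3 * (2 * (1 + 1 / ν)) ^ 3)
          * Real.exp (-(r * (Site.tdist (P := F.P K) (siteShift (sites_eq F n K h) y'.src) (siteShift (sites_eq F n K h) y.src) : ℝ))) * ‖Z‖ := by
  classical
  rw [LinearMap.comp_apply]
  exact kernelRow_comp_outer (toL2B F n cB) (toL2B F n cB) (toL2B F n cB) (fun x z : Site (F.P K) (K - n) => (Site.tdist x z : ℝ))
    (fun _ _ => Nat.cast_nonneg _) (tdist_coarse_triangle F) (fun y : PBond (F.P n) 0 => siteShift (sites_eq F n K h) y.src)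
    (fun y : PBond (F.P n) 0 => siteShift (sites_eq F n K h) y.src) (fun y : PBond (F.P n) 0 => siteShift (sites_eq F n K h) y.src) M₂ M₁ hC₂ hC₁ hr hr₂ hr₁
    (fun x => sum_coarse_pbond_exp_neg_tdist_le F n K h x hν) h₂ h₁ y Z y'

/-- CC is invariant under `M ↦ −M`. [folklore] -/
theorem kernelRow_CC_neg (M : WL2 ℂ (fun _ : PBond (F.P n) 0 => cB) W₂ →ₗ[ℂ] WL2 ℂ (fun _ : PBond (F.P n) 0 => cB) W₂) {C μ : ℝ}
    (hM : ∀ (y : PBond (F.P n) 0) (Z : Matrix (Fin 2) (Fin 2) ℂ) (y' : PBond (F.P n) 0),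
      ‖(toL2B F n cB).symm (M (toL2B F n cB (Pi.single y Z))) y'‖
        ≤ C * Real.exp (-(μ * (Site.tdist (P := F.P K) (siteShift (sites_eq F n K h) y'.src) (siteShift (sites_eq F n K h) y.src) : ℝ))) * ‖Z‖)
    (y : PBond (F.P n) 0) (Z : Matrix (Fin 2) (Fin 2) ℂ) (y' : PBond (F.P n) 0) :
    ‖(toL2B F n cB).symm ((-M) (toL2B F n cB (Pi.single y Z))) y'‖
      ≤ C * Real.exp (-(μ * (Site.tdist (P := F.P K) (siteShift (sites_eq F n K h) y'.src) (siteShift (sites_eq F n K h) y.src) : ℝ))) * ‖Z‖ :=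
  row_neg (toL2B F n cB) (fun x z : Site (F.P K) (K - n) => (Site.tdist x z : ℝ)) (fun y : PBond (F.P n) 0 => siteShift (sites_eq F n K h) y.src) M hM y Z y'

/-- The coarse volume in the gauge's orientation: `Σ_{y} e^{−ν·tdist(ŷ, x)} ≤ 3·(2(1+1∕ν))³`. [cite: Balaban1985BackgroundPropagators, (3.49) p.399] -/
theorem sum_coarse_exp_neg_tdist_le' {ν : ℝ} (hν : 0 < ν) (x : Site (F.P K) (K - n)) :
    ∑ y : PBond (F.P n) 0, Real.exp (-(ν * (Site.tdist (P := F.P K) (siteShift (sites_eq F n K h) y.src) x : ℝ))) ≤ 3 * (2 * (1 + 1 / ν)) ^ 3 :=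
  le_of_eq_of_le (Finset.sum_congr rfl fun y _ => by rw [tdist_coarse_comm]) (sum_coarse_pbond_exp_neg_tdist_le F n K h x hν)

/-- ★★★ **THE NEUMANN INVERSE ON THE COARSE CARRIER**: CC(B; C, μ), `0 ≤ C`, `0 ≤ r < μ`, `C·3(2(1+1∕(μ−r)))³ < 1`, and ANY `U` with `(1 − B)·U = 1` ⟹ CC(U; 1∕(1 − C·3(2(1+1∕(μ−r)))³), r)
— the smallness carries NO `ℓ³` (K-free at the pins). [cite: Balaban1985BackgroundPropagators, (3.86) p.409, (3.131)–(3.132) pp.421–422] -/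
theorem kernelRow_CC_inverse (B U : WL2 ℂ (fun _ : PBond (F.P n) 0 => cB) W₂ →ₗ[ℂ] WL2 ℂ (fun _ : PBond (F.P n) 0 => cB) W₂) {C μ r : ℝ} (hC : 0 ≤ C) (hr : 0 ≤ r) (hrμ : r < μ)
    (hsmall : C * (3 * (2 * (1 + 1 / (μ - r))) ^ 3) < 1)
    (hB : ∀ (y : PBond (F.P n) 0) (Z : Matrix (Fin 2) (Fin 2) ℂ) (y' : PBond (F.P n) 0),
      ‖(toL2B F n cB).symm (B (toL2B F n cB (Pi.single y Z))) y'‖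
        ≤ C * Real.exp (-(μ * (Site.tdist (P := F.P K) (siteShift (sites_eq F n K h) y'.src) (siteShift (sites_eq F n K h) y.src) : ℝ))) * ‖Z‖)
    (hU : (1 - B) * U = 1) (y : PBond (F.P n) 0) (Z : Matrix (Fin 2) (Fin 2) ℂ) (y' : PBond (F.P n) 0) :
    ‖(toL2B F n cB).symm (U (toL2B F n cB (Pi.single y Z))) y'‖
      ≤ (1 / (1 - C * (3 * (2 * (1 + 1 / (μ - r))) ^ 3)))
          * Real.exp (-(r * (Site.tdist (P := F.P K) (siteShift (sites_eq F n K h) y'.src) (siteShift (sites_eq F n K h) y.src) : ℝ))) * ‖Z‖ := by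
  classical
  have hν : 0 < μ - r := by linarith
  exact row_inverse_of_row (toL2B F n cB) (fun x z : Site (F.P K) (K - n) => (Site.tdist x z : ℝ)) (fun y : PBond (F.P n) 0 => siteShift (sites_eq F n K h) y.src)
    (tdist_coarse_self F) (tdist_coarse_triangle F) B U hC hr (sum_coarse_exp_neg_tdist_le' F h hν) hsmall hB hU y Z y'

/-- ★ **EXISTENCE + ROW OF THE COARSE INVERSE**: CC(B; C, μ), `0 ≤ C`, `0 ≤ r < μ`, `C·3(2(1+1∕(μ−r)))³ < 1` ⟹ `1 − B` has a two-sided inverse `U` with CC(U; 1∕(1 − C·3(2(1+1∕(μ−r)))³), r).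
[cite: Balaban1985BackgroundPropagators, (3.86) p.409, (3.131)–(3.132) pp.421–422; Balaban1984PropagatorsII, §2] -/
theorem exists_inverse_CC (B : WL2 ℂ (fun _ : PBond (F.P n) 0 => cB) W₂ →ₗ[ℂ] WL2 ℂ (fun _ : PBond (F.P n) 0 => cB) W₂) {C μ r : ℝ} (hC : 0 ≤ C) (hr : 0 ≤ r) (hrμ : r < μ)
    (hsmall : C * (3 * (2 * (1 + 1 / (μ - r))) ^ 3) < 1)
    (hB : ∀ (y : PBond (F.P n) 0) (Z : Matrix (Fin 2) (Fin 2) ℂ) (y' : PBond (F.P n) 0),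
      ‖(toL2B F n cB).symm (B (toL2B F n cB (Pi.single y Z))) y'‖
        ≤ C * Real.exp (-(μ * (Site.tdist (P := F.P K) (siteShift (sites_eq F n K h) y'.src) (siteShift (sites_eq F n K h) y.src) : ℝ))) * ‖Z‖) :
    ∃ U : WL2 ℂ (fun _ : PBond (F.P n) 0 => cB) W₂ →ₗ[ℂ] WL2 ℂ (fun _ : PBond (F.P n) 0 => cB) W₂, (1 - B) * U = 1 ∧ U * (1 - B) = 1 ∧
      ∀ (y : PBond (F.P n) 0) (Z : Matrix (Fin 2) (Fin 2) ℂ) (y' : PBond (F.P n) 0),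
        ‖(toL2B F n cB).symm (U (toL2B F n cB (Pi.single y Z))) y'‖
          ≤ (1 / (1 - C * (3 * (2 * (1 + 1 / (μ - r))) ^ 3)))
              * Real.exp (-(r * (Site.tdist (P := F.P K) (siteShift (sites_eq F n K h) y'.src) (siteShift (sites_eq F n K h) y.src) : ℝ))) * ‖Z‖ := by
  classical
  haveI : FiniteDimensional ℂ (WL2 ℂ (fun _ : PBond (F.P n) 0 => cB) W₂) := LinearEquiv.finiteDimensional (toL2B F n cB)
  have hν : 0 < μ - r := by linarith
  exact exists_inverse_row (toL2B F n cB) (fun x z : Site (F.P K) (K - n) => (Site.tdist x z : ℝ)) (fun y : PBond (F.P n) 0 => siteShift (sites_eq F n K h) y.src)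
    (tdist_coarse_self F) (tdist_coarse_triangle F) B hC hr (sum_coarse_exp_neg_tdist_le' F h hν) hsmall hB

end Coarse

end Summit.QuantumFields.YangMills.Theorems.Prop7CoarseKernelRowNeumann

end
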